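import Literature.AnabelianGeometry.SemiGraphs.ArithBranchGeometricPart
import Literature.AnabelianGeometry.SemiGraphs.TemperedCompactInVerticialAt
import HarnessLib

/-!
# [SemiAnbd] §5: the geometric part of the arithmetic branch group — AT ONE GRAPH (proof-only twin)

Mochizuki, *Semi-graphs of Anabelioids*, Publ. RIMS **42** (2006) 221–322, §5 p. 65 (the decomposition
groups `Π^temp_{𝔊,b} ⊆ Π^temp_{𝔊,v}` "may be thought of as the commensurator in `Π^temp_{𝔊,v}` of
`Π^temp_{𝔾,b}`") with Thm 3.7 (iii) pp. 40–41. [cite: MochizukiSemiAnbd2006, §5, p. 65]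

PROOF-ONLY companion of `ArithBranchGeometricPart.lean` (abc-iut cell, L3-lead ruling α4-3 (iv)
«φ2-CONSUMERS»: the T54 consumers of the named fact `CompactInVerticial` are twinned by their author,
seat abc-iut-w4-d040): the four theorems of the original that carry `hCV : CompactInVerticial` (Thm 3.7
(iii) quantified over ALL countable graphs) are restated with the PER-GRAPH hypothesis
`h : CompactInVerticialAt 𝒢` of abc-iut-w4-d075's `TemperedCompactInVerticialAt.lean` (the body of the
frozen def at the one graph `𝒢` in play), uniform decl suffix `At`, proofs ported verbatim with
`hCV 𝒢 ↦ h`; the originals are untouched and are recovered through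
`compactInVerticialAt_of_compactInVerticial`.  Point of the twin: the programme produces Thm 3.7 (iii)
per graph (finite `𝔾`: `compactInVerticialAt_of_finiteLevelData` / `_of_finite`), which the ∀-graph binder
cannot consume.  No definition, no new named fact; nothing here takes a side on [IUTchIII] Cor. 3.12.
-/

namespace Literature.AnabelianGeometry.SemiGraphs

namespace ProfiniteSemiGraph

open CategoryTheory Topology
open scoped Pointwise

universe u u'

variable {𝒢 : ProfiniteSemiGraph.{u}}

/-- **`C(L) ∩ H = L` for an edge-like `L` inside ANY verticial `H`**, AT ONE GRAPH: twin of
`commensurator_inf_eq_of_edgeLike_le_verticial` with `CompactInVerticialAt 𝒢` (Thm 3.7 (iii) at `𝒢`)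
in place of the ∀-graph `CompactInVerticial`. [cite: MochizukiSemiAnbd2006, Thm 3.7 (iii) / §5, pp. 41, 65] -/
theorem commensurator_inf_eq_of_edgeLike_le_verticialAt (h : CompactInVerticialAt 𝒢)
    (h𝒢 : 𝒢.Thm37Hypotheses) (hG : 𝒢.graph.IsGraph) (c : TemperedPiChart 𝒢) {b : 𝒢.graph.Branch}
    {w : 𝒢.graph.Vertex} {L H : Subgroup c.G} (hL : L ∈ edgeLikeSubgroups c (𝒢.graph.edgeOf b))
    (hH : H ∈ verticialSubgroups c w) (hLH : L ≤ H) :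
    Subgroup.Commensurable.commensurator L ⊓ H = L := by
  classical
  have hVD := verticialDistinct_holds.{u}
  have hVI := verticialInjective_holds.{u}
  haveI := TemperedPiChart.t2Space c
  have hΦ' : ∀ v : 𝒢.graph.Vertex, ∃ φ : 𝒢.Gv v →ₜ* c.G, IsVerticialHom c v φ := by
    intro v
    obtain ⟨K, φ, hφ, -⟩ := (hVI 𝒢 h𝒢 c v).1
    exact ⟨φ, hφ⟩
  choose Φ hΦ using hΦ'
  -- the two branches of the edge of `b`, their vertices, and the two presentations of `L`
  obtain ⟨b₁, b₂, h12, h1e, h2e, hall⟩ := 𝒢.graph.two_branches (𝒢.graph.edgeOf b)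
  obtain ⟨u₁, hb₁⟩ := Option.isSome_iff_exists.mp (hG.abuts_isSome b₁)
  obtain ⟨u₂, hb₂⟩ := Option.isSome_iff_exists.mp (hG.abuts_isSome b₂)
  have hL₁ : L ∈ edgeLikeSubgroups c (𝒢.graph.edgeOf b₁) := by rw [h1e]; exact hL
  have hL₂ : L ∈ edgeLikeSubgroups c (𝒢.graph.edgeOf b₂) := by rw [h2e]; exact hL
  obtain ⟨g₁, hLeq₁⟩ := edgeLike_eq_map_branchSubgroup c hb₁ hL₁ (Φ u₁) (hΦ u₁)
  obtain ⟨g₂, hLeq₂⟩ := edgeLike_eq_map_branchSubgroup c hb₂ hL₂ (Φ u₂) (hΦ u₂)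
  set K₁ := (Φ u₁).toMonoidHom.range.map (MulAut.conj g₁).toMonoidHom with hK₁
  set K₂ := (Φ u₂).toMonoidHom.range.map (MulAut.conj g₂).toMonoidHom with hK₂
  have hK₁m : K₁ ∈ verticialSubgroups c u₁ :=
    conj_mem_verticialSubgroups c (range_mem_verticialSubgroups c (Φ u₁) (hΦ u₁)) g₁
  have hK₂m : K₂ ∈ verticialSubgroups c u₂ :=
    conj_mem_verticialSubgroups c (range_mem_verticialSubgroups c (Φ u₂) (hΦ u₂)) g₂
  have hLK₁ : L ≤ K₁ := by rw [hLeq₁]; exact Subgroup.map_mono (Subgroup.map_le_range _ _)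
  have hLK₂ : L ≤ K₂ := by rw [hLeq₂]; exact Subgroup.map_mono (Subgroup.map_le_range _ _)
  haveI := infinite_of_mem_edgeLikeSubgroups hVI h𝒢 c hL
  have hLne : L ≠ ⊥ := fun h0 => by
    rw [h0] at this
    exact not_finite (⊥ : Subgroup c.G)
  have hKK : K₁ ≠ K₂ := by
    intro hKK
    refine h12 (branch_eq_of_hosts_eq hVD hVI h𝒢 c Φ hΦ hLne hb₁ hb₂ g₁ g₂ ?_ ?_ hKK)
    · rw [← hLeq₁]
    · rw [← hLeq₂]
  -- by Thm 3.7 (iii) at `𝒢` ("precisely two") the host `H` is `K₁` or `K₂`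
  have hLc : IsCompact (L : Set c.G) := isCompact_of_mem_edgeLikeSubgroups c hL
  obtain ⟨honly, -⟩ := (h h𝒢 c L hLc).2 hLne u₁ u₂ K₁ K₂ hK₁m hK₂m hKK hLK₁ hLK₂
  -- the host presentation `g φ_u` as ONE injective continuous homomorphism
  have key : ∀ {u : 𝒢.graph.Vertex} {b' : 𝒢.graph.Branch} (hb' : 𝒢.graph.abuts b' = some u) (g : c.G),
      L = ((𝒢.branchSubgroup b' u hb').map (Φ u).toMonoidHom).map (MulAut.conj g).toMonoidHom →
      H = (Φ u).toMonoidHom.range.map (MulAut.conj g).toMonoidHom →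
      Subgroup.Commensurable.commensurator L ⊓ H = L := by
    intro u b' hb' g hLe hHe
    let ψ : 𝒢.Gv u →ₜ* c.G :=
      { toMonoidHom := (MulAut.conj g).toMonoidHom.comp (Φ u).toMonoidHom
        continuous_toFun := by
          exact ((continuous_const.mul continuous_id).mul continuous_const).comp (Φ u).continuous }
    have hψinj : Function.Injective ψ :=
      (MulAut.conj g).injective.comp ((hVI 𝒢 h𝒢 c u).2 (Φ u) (hΦ u))
    have hrange : ψ.toMonoidHom.range = H := by
      rw [hHe, MonoidHom.range_eq_map, MonoidHom.range_eq_map, Subgroup.map_map]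
    have hLψ : ((𝒢.branchSubgroup b' u hb').map (MulAut.conj (1 : 𝒢.Gv u)).toMonoidHom).map
        ψ.toMonoidHom = L := by
      have h1 : (𝒢.branchSubgroup b' u hb').map (MulAut.conj (1 : 𝒢.Gv u)).toMonoidHom =
          𝒢.branchSubgroup b' u hb' := by ext x; simp
      rw [h1, hLe, Subgroup.map_map]
    have hc := commensurator_branch_inf_host_eq h𝒢 c hb' ψ hψinj 1
    rw [hLψ, hrange] at hc
    exact hc
  rcases honly w H hH hLH with rfl | rfl
  · exact key hb₁ g₁ hLeq₁ rfl
  · exact key hb₂ g₂ hLeq₂ rfl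

/-! ### LEVEL A at one graph -/

variable {c : TemperedPiChart 𝒢} {Gtp : Type u'} [Group Gtp]

/-- **`Π^temp_{𝔊,b} ∩ Π^temp_𝔾 = Π^temp_{𝔾,b}`** for the produced data, AT ONE GRAPH: twin of
`arithBrGp_inf_range_eq_map` with `CompactInVerticialAt 𝒢`. [cite: MochizukiSemiAnbd2006, §5, p. 65] -/
theorem arithBrGp_inf_range_eq_mapAt (h : CompactInVerticialAt 𝒢) (h𝒢 : 𝒢.Thm37Hypotheses)
    (hG : 𝒢.graph.IsGraph) (R : ChartRepresentatives c) (ι : c.G →* Gtp) (hι : Function.Injective ι)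
    (b : 𝒢.graph.Branch) : arithBrGp R ι b ⊓ ι.range = (R.Hb b).map ι := by
  obtain ⟨v, hbv⟩ := Option.isSome_iff_exists.mp (hG.abuts_isSome b)
  rw [arithBrGp_inf_range R hι hbv (commensurator_eq_of_mem_verticialSubgroups h𝒢 c (R.Hv_mem v)),
    inf_comm, commensurator_inf_eq_of_edgeLike_le_verticialAt h h𝒢 hG c (R.Hb_mem b) (R.Hv_mem v)
      (R.Hb_le b v hbv)]

/-- The branch half of the T54-2 input (H-DEF) in `aug`-currency, AT ONE GRAPH: twin of
`decompositionDataOfChart_brGp_inf_ker` with `CompactInVerticialAt 𝒢`.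
[cite: MochizukiSemiAnbd2006, §5, p. 65] -/
theorem decompositionDataOfChart_brGp_inf_kerAt (h : CompactInVerticialAt 𝒢) (h𝒢 : 𝒢.Thm37Hypotheses)
    (hG : 𝒢.graph.IsGraph) (R : ChartRepresentatives c) (ι : c.G →* Gtp) (hι : Function.Injective ι)
    {PA : Type*} [Group PA] (aug : Gtp →* PA) (hexact : ι.range = aug.ker) (b : 𝒢.graph.Branch) :
    ∃ e : 𝒢.graph.Edge, ∃ L ∈ edgeLikeSubgroups c e,
      (decompositionDataOfChart R ι).brGp b ⊓ aug.ker = L.map ι := by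
  refine ⟨𝒢.graph.edgeOf b, R.Hb b, R.Hb_mem b, ?_⟩
  rw [decompositionDataOfChart_brGp, ← hexact, arithBrGp_inf_range_eq_mapAt h h𝒢 hG R ι hι b]

/-- **(H-DEF) at LEVEL A, both halves, AT ONE GRAPH** — twin of `intersectionWithGeometricStatement_ofChart`
with `CompactInVerticialAt 𝒢`: the typed second sentence of Rmk 5.3.1 for the produced data, modulo the
(H-OUT) inputs `hVout`, `hBout`. [cite: MochizukiSemiAnbd2006, Rmk 5.3.1, p. 65] -/
theorem intersectionWithGeometricStatement_ofChartAt (h : CompactInVerticialAt 𝒢)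
    (h𝒢 : 𝒢.Thm37Hypotheses) (hG : 𝒢.graph.IsGraph) (R : ChartRepresentatives c) (ι : c.G →* Gtp)
    (hι : Function.Injective ι) {PA : Type*} [Group PA] (aug : Gtp →* PA) (hexact : ι.range = aug.ker)
    (hVout : ∀ (g : Gtp) (K : Subgroup Gtp),
      (∃ w : 𝒢.graph.Vertex, ∃ H ∈ verticialSubgroups c w, K = H.map ι) →
        ∃ w : 𝒢.graph.Vertex, ∃ H ∈ verticialSubgroups c w, conjSubgroup g K = H.map ι)
    (hBout : ∀ (g : Gtp) (K : Subgroup Gtp),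
      (∃ e : 𝒢.graph.Edge, ∃ L ∈ edgeLikeSubgroups c e, K = L.map ι) →
        ∃ e : 𝒢.graph.Edge, ∃ L ∈ edgeLikeSubgroups c e, conjSubgroup g K = L.map ι) :
    IntersectionWithGeometricStatement (decompositionDataOfChart R ι) aug
      (fun K => ∃ w : 𝒢.graph.Vertex, ∃ H ∈ verticialSubgroups c w, K = H.map ι)
      (fun K => ∃ e : 𝒢.graph.Edge, ∃ L ∈ edgeLikeSubgroups c e, K = L.map ι) :=
  intersectionWithGeometricStatement_of_chart_of_forall c (decompositionDataOfChart R ι) ι aug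
    (fun v => (decompositionDataOfChart_vertGp_inf_ker h𝒢 R ι hι aug hexact v).1) hVout
    (fun b => decompositionDataOfChart_brGp_inf_kerAt h h𝒢 hG R ι hι aug hexact b) hBout

end ProfiniteSemiGraph

end Literature.AnabelianGeometry.SemiGraphs
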